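import Literature.Computability.AlgebraicComplexity.BorderRankMatMulSmallProofs
import Literature.Computability.AlgebraicComplexity.BorderRankMatMulRectangular
import HarnessLib

/-!
# `bR(⟨2,2,4⟩) ≤ 13` (Alekseev–Smirnov 2013 glued to Bini et al. 1979; Landsberg–Ryder 2017 §3, Prop. 3.1): the `n = 4` cell of Smirnov's `R̲(M_⟨2,2,n⟩) ≤ 3n + 1`, proved

Topic `Literature/Computability/AlgebraicComplexity`; sibling of `BorderRankMatMulRectangular.lean`,
whose named fact `Smirnov2013_borderRank_matMulTensor_22n_le : ∀ n, 1 ≤ n → n ≤ 7 →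
algBorderRank (matMulTensor ℂ 2 2 n) ≤ 3n + 1` (A. V. Smirnov 2013, as quoted by Conner–Harper–
Landsberg 2023, p. 4) has its cases `n ≤ 3` proved in tree (`4`, Strassen's `7`, Bini et al.'s `10`)
and `n ≥ 4` open in tree. THIS FILE PROVES THE CASE `n = 4`: `R̲(M_⟨2,2,4⟩) ≤ 13`, over every
field in which `2 ≠ 0`, by a kernel-checked integer certificate for an explicit order-`2` approximate
decomposition of `2·⟨4,2,2⟩` with `13` triads.

## The scheme (Landsberg–Ryder 2017, §3 Prop. 3.1 and §§6–7; Landsberg 2017, §4.8 and Ex. 3.2.2.1)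

Write `T_{BCLRS,m} := M_⟨m,2,2⟩ − x¹₁ ⊗ (y¹₁ ⊗ z¹₁ + y¹₂ ⊗ z²₁)` (an `m × 2` by `2 × 2` product with the
entry `x¹₁` set to zero; Landsberg–Ryder 2017, §2). Prop. 3.1 of Landsberg–Ryder: if
`R̲(T_{BCLRS,m}) ≤ r` and `R̲(T_{BCLRS,m'}) ≤ r'` then `R̲(M_⟨m+m'−1,2,2⟩) ≤ r + r'` — glue the two
reduced products along a shared row, each supplying one of the two entries of that row. With
`R̲(T_{BCLRS,2}) ≤ 5` (Bini–Capovani–Romani–Lotti 1979; the five triads `p₁,…,p₅` of Landsberg–Ryder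
§6 = Landsberg 2017 (4.8.1), order `1`) and `R̲(T_{BCLRS,3}) ≤ 8` (Alekseev–Smirnov 2013, Thm. 2; the
eight triads `p₁,…,p₈` of Landsberg–Ryder §7 = Landsberg 2017 §4.8.2, order `2`, coefficients
`±1, ±½`) this gives `R̲(M_⟨4,2,2⟩) ≤ 13`.

Below, the `5 + 8` triads are transported to the tree's `⟨4,2,2⟩ = matMulTensor K 4 2 2` (a `4 × 2`
matrix `A` times a `2 × 2` matrix `B`; slots `C = (i,u)`, `A = (i,α)`, `B = (α,u)`, `0`-based): the
BCLR block on rows `{0,1}` with its missing entry at `(1,1)`, the Alekseev–Smirnov block on rows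
`{1,2,3}` with its missing entry at `(1,0)`; the BCLR triads are multiplied by `ε` (to order `2`) and
every triad is doubled in exactly one factor (clearing the halves), so that all coefficients are
integers and `∑ₜ Uₜ ⊗ Vₜ ⊗ Wₜ = 2·ε²·⟨4,2,2⟩ + O(ε³)`. Two misprints of the printed sources were
corrected (found and confirmed by exact rational arithmetic before transcription; the kernel check
below is the proof): in BCLR's `p₂` the last factor is `z²₂ + ε(z¹₁ − z²₁)` (printed `+`), and in
Alekseev–Smirnov's `p₁` the middle term of the first factor is `−½ ε x²₂` (printed `x²₁`).

## Contents (all proved; no definitions of mathematical objects, no named facts)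

* `AlekseevSmirnov2013.uMats / vMats / wMats`, `…Tab` — the integer coefficient tables (ascending
  coefficient lists, the `Smirnov2013.toPoly` encoding of `BorderRankMatMulSmallProofs.lean`).
* `AlekseevSmirnov2013.entryPoly`, `rhsZ`, `check422`, `check422_eq_true`, `coeffL_entryPoly` — the finite
  check of all `8·8·4` entries in degrees `0,1,2` against `2·ε²·⟨4,2,2⟩`, run by the kernel
  (`decide +kernel`).
* `AlekseevSmirnov2013.isApproxDecomposition` — transport to `K[ε]` for a field `K` with `2 ≠ 0`
  (the `C`-slot vectors carry the factor `2⁻¹`).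
* `approxRank_two_matMulTensor_422_le`, `algBorderRank_matMulTensor_422_le / _224_le / _242_le` —
  **`R₂(⟨4,2,2⟩) ≤ 13`, hence `bR ≤ 13` in the three cyclic formats** (`approxRank_matMulTensor_rotate_le`).
* `Smirnov2013_borderRank_matMulTensor_22n_le_four` — the case `n = 4` of the named fact, over `ℂ`.

## References

* [AlekseevSmirnov2013] V. B. Alekseev, A. V. Smirnov, *On the exact and approximate bilinear
  complexities of multiplication of `4 × 2` and `2 × 2` matrices*, Proc. Steklov Inst. Math. 282,
  Suppl. 1 (2013) S123–S139 — Thm. 2 (the `8`-term scheme), read through Landsberg–Ryder §7.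
* [LandsbergRyder2015] J. M. Landsberg, N. Ryder, *On the geometry of border rank algorithms for
  `n × 2` by `2 × 2` matrix multiplication*, Exp. Math. 26 (2017) 275–286 = arXiv:1509.08323 (held;
  §2 definition of `T_{BCLRS,m}`, §3 Prop. 3.1, §6 `p₁–p₅`, §7 `p₁–p₈`).
* [LandsbergGCT2017] J. M. Landsberg, *Geometry and Complexity Theory*, CUP 2017 (held), §4.8.1
  (4.8.1), §4.8.2 (p. 108), Exercise 3.2.2.1.
* [BiniCapovaniRomaniLotti1979] D. Bini, M. Capovani, F. Romani, G. Lotti, Inform. Process. Lett. 8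
  (1979) 234–235.
* [Blaser2013] M. Bläser, *Fast Matrix Multiplication*, Theory of Computing, Graduate Surveys 5 (2013)
  — Def. 6.1, Thm. 6.3(1).
-/

noncomputable section

open scoped BigOperators Polynomial
open Polynomial

namespace Literature.Computability.AlgebraicComplexity

namespace AlekseevSmirnov2013

open Smirnov2013

/-! ## The data: `13` triads for `2·ε²·⟨4,2,2⟩` (BCLR rows `{0,1}`, Alekseev–Smirnov rows `{1,2,3}`) -/

/-- `Uₜ ∈ ℤ[ε]^{4×2}` (`t = 1,…,13`): the vectors on the product slot `C = (i,u)`, as ascending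
coefficient lists; triads `1–5` are BCLR's `p₁–p₅` (times `ε`), `6–13` Alekseev–Smirnov's `p₁–p₈`.
[cite: LandsbergRyder2015, §6–§7] [cite: AlekseevSmirnov2013, Thm. 2] -/
def uMats : List (Fin 4 → Fin 2 → List ℤ) :=
  [![![[], [0, 1]], ![[0, 0, 1], []], ![[], []], ![[], []]],
    ![![[], [0, 1]], ![[0, 0, 1], [0, 0, -1]], ![[], []], ![[], []]],
    ![![[0, 1], [0, 1]], ![[], []], ![[], []], ![[], []]],
    ![![[0, 1], []], ![[], []], ![[], []], ![[], []]],
    ![![[], [0, 1]], ![[], []], ![[], []], ![[], []]],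
    ![![[], []], ![[], []], ![[0, 1], []], ![[1], []]],
    ![![[], []], ![[], []], ![[0, 1], [0, 1]], ![[1], [1]]],
    ![![[], []], ![[], []], ![[], []], ![[], [1]]],
    ![![[], []], ![[], []], ![[], []], ![[1], []]],
    ![![[], []], ![[0, 0, -2], []], ![[0, 1], [0, 1]], ![[], [2]]],
    ![![[], []], ![[], []], ![[], [0, 1]], ![[], [1]]],
    ![![[], []], ![[], []], ![[], []], ![[-1], [1]]],
    ![![[], []], ![[], [0, 0, 2]], ![[0, 1], [0, 1]], ![[2], []]]]

/-- `Vₜ ∈ ℤ[ε]^{4×2}`: the vectors on the left-factor slot `A = (i,α)` (BCLR's `x`-factors doubled;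
Alekseev–Smirnov's `x`-factors doubled except in triads `10` and `13`).
[cite: LandsbergRyder2015, §6–§7] [cite: AlekseevSmirnov2013, Thm. 2] -/
def vMats : List (Fin 4 → Fin 2 → List ℤ) :=
  [![![[], []], ![[2], []], ![[], []], ![[], []]],
    ![![[0, 2], []], ![[-2], []], ![[], []], ![[], []]],
    ![![[], [2]], ![[], []], ![[], []], ![[], []]],
    ![![[0, -2], [2]], ![[], []], ![[], []], ![[], []]],
    ![![[], [-2]], ![[-2], []], ![[], []], ![[], []]],
    ![![[], []], ![[], []], ![[2], [0, -1]], ![[], [0, 0, -1]]],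
    ![![[], []], ![[], [1]], ![[2], []], ![[], []]],
    ![![[], []], ![[], []], ![[-2], [0, -1]], ![[0, 2], [0, 0, 2]]],
    ![![[], []], ![[], []], ![[2], [0, -1]], ![[0, -2], [0, 0, 1]]],
    ![![[], []], ![[], [-1]], ![[], [0, 1]], ![[], [0, 0, -1]]],
    ![![[], []], ![[], []], ![[2], [0, 1]], ![[], []]],
    ![![[], []], ![[], [1]], ![[2], []], ![[0, -2], []]],
    ![![[], []], ![[], [1]], ![[], [0, 1]], ![[], []]]]

/-- `Wₜ ∈ ℤ[ε]^{2×2}`: the vectors on the right-factor slot `B = (α,u)`.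
[cite: LandsbergRyder2015, §6–§7] [cite: AlekseevSmirnov2013, Thm. 2] -/
def wMats : List (Fin 2 → Fin 2 → List ℤ) :=
  [![![[1], [1]], ![[], []]],
    ![![[], [1]], ![[], []]],
    ![![[1], []], ![[], [0, 1]]],
    ![![[-1], []], ![[0, 1], [0, -1]]],
    ![![[1], []], ![[], []]],
    ![![[0, 1], []], ![[-1], [1]]],
    ![![[], []], ![[1], [-1]]],
    ![![[], [0, 1]], ![[1], [1]]],
    ![![[0, -1], []], ![[1], [1]]],
    ![![[], []], ![[1], []]],
    ![![[], [0, 1]], ![[-1], [1]]],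
    ![![[], []], ![[1], [1]]],
    ![![[], []], ![[], [1]]]]

/-- `Uₜ` indexed by `t : Fin 13`. [cite: LandsbergRyder2015, §6–§7] -/
def uTab (t : Fin 13) : Fin 4 → Fin 2 → List ℤ := uMats.getD t fun _ _ => []

/-- `Vₜ` indexed by `t : Fin 13`. [cite: LandsbergRyder2015, §6–§7] -/
def vTab (t : Fin 13) : Fin 4 → Fin 2 → List ℤ := vMats.getD t fun _ _ => []

/-- `Wₜ` indexed by `t : Fin 13`. [cite: LandsbergRyder2015, §6–§7] -/
def wTab (t : Fin 13) : Fin 2 → Fin 2 → List ℤ := wMats.getD t fun _ _ => []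

/-! ## The finite check -/

/-- The integer polynomial `∑ₜ Uₜ(i,l) Vₜ(j,m) Wₜ(k,n)`: entry `((i,l),(j,m),(k,n))` of
`∑ₜ Uₜ ⊗ Vₜ ⊗ Wₜ`. [cite: LandsbergRyder2015, §3 Prop. 3.1] -/
def entryPoly (i : Fin 4) (l : Fin 2) (j : Fin 4) (m k n : Fin 2) : List ℤ :=
  psum (List.ofFn fun t : Fin 13 => pmul (pmul (uTab t i l) (vTab t j m)) (wTab t k n))

/-- The expected coefficients: `2·ε²·⟨4,2,2⟩`, i.e. `2` in degree `2` at the entries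
`((i,l),(i,m),(m,l))` and `0` otherwise / below. [cite: LandsbergRyder2015, §3 Prop. 3.1] -/
def rhsZ (i : Fin 4) (l : Fin 2) (j : Fin 4) (m k n : Fin 2) (d : ℕ) : ℤ :=
  if d = 2 then (if i = j ∧ m = k ∧ l = n then 2 else 0) else 0

/-- The whole finite check: all `8 · 8 · 4` entries, degrees `0, 1, 2`.
[cite: LandsbergRyder2015, §3 Prop. 3.1] -/
def check422 : Bool :=
  (List.finRange 4).all fun i => (List.finRange 2).all fun l => (List.finRange 4).all fun j =>
    (List.finRange 2).all fun m => (List.finRange 2).all fun k => (List.finRange 2).all fun n =>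
      (List.range 3).all fun d => coeffL (entryPoly i l j m k n) d == rhsZ i l j m k n d

/-- The kernel runs the check. [cite: LandsbergRyder2015, §3 Prop. 3.1] -/
theorem check422_eq_true : check422 = true := by
  decide +kernel

/-- Unpacking `check422`: entry by entry, degree by degree. [cite: LandsbergRyder2015, §3 Prop. 3.1] -/
theorem coeffL_entryPoly (i : Fin 4) (l : Fin 2) (j : Fin 4) (m k n : Fin 2) {d : ℕ} (hd : d ≤ 2) :
    coeffL (entryPoly i l j m k n) d = rhsZ i l j m k n d := by
  have h := check422_eq_true
  simp only [check422, List.all_eq_true, beq_iff_eq] at h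
  exact h i (List.mem_finRange i) l (List.mem_finRange l) j (List.mem_finRange j)
    m (List.mem_finRange m) k (List.mem_finRange k) n (List.mem_finRange n) d
    (List.mem_range.2 (by omega))

/-! ## Transport to `K[ε]` (a field with `2 ≠ 0`; the `C`-slot vectors carry `2⁻¹`) -/

section Transport

variable (K : Type*) [Field K]

/-- First vectors `2⁻¹·Uₜ ∈ K[ε]^{4×2}` (slot of the product `C`, index `(i,l)`).
[cite: LandsbergRyder2015, §3 Prop. 3.1] -/
def uC (t : Fin 13) (a : Fin 4 × Fin 2) : K[X] := C (2⁻¹ : K) * toPoly (uTab t a.1 a.2)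

/-- Second vectors `Vₜ ∈ K[ε]^{4×2}` (slot of `A`, index `(j,m)`). [cite: LandsbergRyder2015, §3 Prop. 3.1] -/
def vC (t : Fin 13) (b : Fin 4 × Fin 2) : K[X] := toPoly (vTab t b.1 b.2)

/-- Third vectors `Wₜ ∈ K[ε]^{2×2}` (slot of `B`, index `(k,n)`). [cite: LandsbergRyder2015, §3 Prop. 3.1] -/
def wC (t : Fin 13) (c : Fin 2 × Fin 2) : K[X] := toPoly (wTab t c.1 c.2)

/-- **The glued Bini et al. / Alekseev–Smirnov scheme as an order-`2` approximate decomposition of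
`⟨4,2,2⟩` with `13` triads**, over every field with `2 ≠ 0`:
`∑ₜ (2⁻¹Uₜ) ⊗ Vₜ ⊗ Wₜ = ε² ⟨4,2,2⟩ + O(ε³)`.
[cite: LandsbergRyder2015, §3 Prop. 3.1] [cite: AlekseevSmirnov2013, Thm. 2] -/
theorem isApproxDecomposition (h2 : (2 : K) ≠ 0) :
    IsApproxDecomposition 2 (matMulTensor K 4 2 2) (uC K) (vC K) (wC K) := by
  intro a b c d hd
  have hsum : (∑ t, uC K t a * vC K t b * wC K t c) =
      C (2⁻¹ : K) * toPoly (entryPoly a.1 a.2 b.1 b.2 c.1 c.2) := by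
    rw [entryPoly, toPoly_psum, List.map_ofFn, List.sum_ofFn, Finset.mul_sum]
    refine Finset.sum_congr rfl fun t _ => ?_
    simp only [Function.comp_apply, toPoly_pmul, uC, vC, wC]
    ring
  rw [hsum, coeff_C_mul, coeff_toPoly, coeffL_entryPoly _ _ _ _ _ _ hd, rhsZ]
  simp only [matMulTensor]
  split_ifs <;> simp [h2]

end Transport

end AlekseevSmirnov2013

/-! ## The bounds -/

section Bounds

variable (K : Type*) [Field K]

/-- **`R₂(⟨4,2,2⟩) ≤ 13`** over every field with `2 ≠ 0` (order-`2` approximate rank, Bläser's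
`R_h`): the glued Bini et al. / Alekseev–Smirnov scheme. [cite: LandsbergRyder2015, §3 Prop. 3.1]
[cite: AlekseevSmirnov2013, Thm. 2] -/
theorem approxRank_two_matMulTensor_422_le (h2 : (2 : K) ≠ 0) :
    approxRank 2 (matMulTensor K 4 2 2) ≤ 13 :=
  approxRank_le_of_isApproxDecomposition (AlekseevSmirnov2013.isApproxDecomposition K h2)

/-- **`bR(⟨4,2,2⟩) ≤ 13`** (a `4 × 2` by a `2 × 2` matrix; Landsberg–Ryder's `M_⟨4,2,2⟩`), over every
field with `2 ≠ 0`. [cite: LandsbergRyder2015, §3 Prop. 3.1] [cite: AlekseevSmirnov2013, Thm. 2] -/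
theorem algBorderRank_matMulTensor_422_le (h2 : (2 : K) ≠ 0) :
    algBorderRank (matMulTensor K 4 2 2) ≤ 13 :=
  (algBorderRank_le_approxRank 2 _).trans (approxRank_two_matMulTensor_422_le K h2)

/-- **`bR(⟨2,2,4⟩) ≤ 13`** (a `2 × 2` by a `2 × 4` matrix — the format of the tree's `(2,2)` column
tower and of `Smirnov2013_borderRank_matMulTensor_22n_le`; cyclic rotation, Bläser Thm. 6.3(1)).
[cite: LandsbergRyder2015, §3 Prop. 3.1] [cite: AlekseevSmirnov2013, Thm. 2] -/
theorem algBorderRank_matMulTensor_224_le (h2 : (2 : K) ≠ 0) :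
    algBorderRank (matMulTensor K 2 2 4) ≤ 13 :=
  (algBorderRank_le_approxRank 2 _).trans
    ((approxRank_matMulTensor_rotate_le K 2 4 2 2).trans (approxRank_two_matMulTensor_422_le K h2))

/-- **`bR(⟨2,4,2⟩) ≤ 13`** (the third cyclic format). [cite: LandsbergRyder2015, §3 Prop. 3.1]
[cite: AlekseevSmirnov2013, Thm. 2] -/
theorem algBorderRank_matMulTensor_242_le (h2 : (2 : K) ≠ 0) :
    algBorderRank (matMulTensor K 2 4 2) ≤ 13 :=
  (algBorderRank_le_approxRank 2 _).trans
    ((approxRank_matMulTensor_rotate_le K 2 2 2 4).trans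
      ((approxRank_matMulTensor_rotate_le K 2 4 2 2).trans (approxRank_two_matMulTensor_422_le K h2)))

end Bounds

/-- **The case `n = 4` of Smirnov's `R̲(M_⟨2,2,n⟩) ≤ 3n + 1`** (named fact
`Smirnov2013_borderRank_matMulTensor_22n_le`, `BorderRankMatMulRectangular.lean`), now a theorem over
`ℂ`: `bR(⟨2,2,4⟩) ≤ 13`. [cite: Smirnov2013, as quoted in ConnerHarperLandsberg2023 §1 p. 4]
[cite: AlekseevSmirnov2013, Thm. 2] -/
theorem Smirnov2013_borderRank_matMulTensor_22n_le_four :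
    algBorderRank (matMulTensor ℂ 2 2 4) ≤ 3 * 4 + 1 :=
  algBorderRank_matMulTensor_224_le ℂ two_ne_zero

end Literature.Computability.AlgebraicComplexity

end
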